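import Mathlib
import HarnessLib
import Literature.Combinatorics.SimpleGraph.ExcludedGridTheorem
import Summits.ValiantsHypothesis.ValiantsHypothesis.Theorems.MonotoneRestorationMonotoneRestorationQPLinearWidthSqrtRungChuzhoyTan

/-!
# Route MonotoneRestoration, crux `MonotoneRestorationQP` (stmt-15886), line `linear_width` —
# THE `√N` RUNG θ_{1/2} CONDITIONAL ON ONE NAMED FACT

Helper file (`--supports stmt-ValiantsHypothesis-15886`), def-free.  The assembly `widthRung_sqrt_of_chuzhoyTan` (p842215)
with its inline hypothesis (CT) replaced by the Literature named fact `ChuzhoyTan2021_excludedGrid` (Chuzhoy–Tan 2021,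
Thm 1.1, the polynomial Excluded Grid Theorem), so that the trust base of the rung is a single named, cited statement.

Honest label: conditional result (named fact undischarged); θ₁, the cruxes and VP ≠ VNP NOT moved; no stub closed by name.
[cite: ChuzhoyTan2021, Theorem 1.1; DawarPagoSeppelt2025, Thm 7.9; Roberson2022, Thm 3.13]
-/

set_option linter.dupNamespace false

noncomputable section

namespace Summit.ValiantsHypothesis.ValiantsHypothesis.Theorems.CFIOddCover

open Literature.Combinatorics.SimpleGraph
open Summit.ValiantsHypothesis.ValiantsHypothesis.Theorems.MonotoneRestorationQPLinearWidth

/-- **θ_{1/2} ON A NAMED FACT.**  The polynomial Excluded Grid Theorem (Chuzhoy–Tan 2021, Thm 1.1, named fact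
`ChuzhoyTan2021_excludedGrid`) implies `WidthRung (fun n => Nat.sqrt n / 45)`: every matrix-symmetric `VP` family of degree
`≤ √n/45` that is `PolylogHomDetermined` has square-symmetric circuits of quasi-polynomial orbit size.
[cite: ChuzhoyTan2021, Theorem 1.1; DawarPagoSeppelt2025, Thm 7.9] -/
theorem widthRung_sqrt_of_excludedGrid (hCT : ChuzhoyTan2021_excludedGrid) :
    WidthRung fun n => Nat.sqrt n / 45 :=
  widthRung_sqrt_of_chuzhoyTan hCT

end Summit.ValiantsHypothesis.ValiantsHypothesis.Theorems.CFIOddCover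

end
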